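import Literature.NumberTheory.LFunctions.WeilFirstPrimeCertificateDataC
import HarnessLib

/-!
# First-prime Weil positivity, stage C: kernel check of the even scaled moments ν_24, ν_26, ν_28, ν_30, ν_32, ν_34

Part of `weilCert3C.check` (`WeilFirstPrimeCertificateDataC.lean`), evaluated by `decide +kernel` and kept in its own
file for kernel time and memory (each declaration is checked separately). Assembled in
`WeilFirstPrimeCertificateCCheck.lean`. Pure proof file; nothing is asserted.
-/

noncomputable section

namespace Literature.NumberTheory.LFunctions

set_option maxHeartbeats 0 in
/-- **Kernel check of the scaled moment `ν_{24}`** of the stage-C first-prime certificate. [folklore] -/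
theorem checkNuAt24_weilCert3C : weilCert3C.checkNuAt 24 = true := by
  decide +kernel

set_option maxHeartbeats 0 in
/-- **Kernel check of the scaled moment `ν_{26}`** of the stage-C first-prime certificate. [folklore] -/
theorem checkNuAt26_weilCert3C : weilCert3C.checkNuAt 26 = true := by
  decide +kernel

set_option maxHeartbeats 0 in
/-- **Kernel check of the scaled moment `ν_{28}`** of the stage-C first-prime certificate. [folklore] -/
theorem checkNuAt28_weilCert3C : weilCert3C.checkNuAt 28 = true := by
  decide +kernel

set_option maxHeartbeats 0 in
/-- **Kernel check of the scaled moment `ν_{30}`** of the stage-C first-prime certificate. [folklore] -/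
theorem checkNuAt30_weilCert3C : weilCert3C.checkNuAt 30 = true := by
  decide +kernel

set_option maxHeartbeats 0 in
/-- **Kernel check of the scaled moment `ν_{32}`** of the stage-C first-prime certificate. [folklore] -/
theorem checkNuAt32_weilCert3C : weilCert3C.checkNuAt 32 = true := by
  decide +kernel

set_option maxHeartbeats 0 in
/-- **Kernel check of the scaled moment `ν_{34}`** of the stage-C first-prime certificate. [folklore] -/
theorem checkNuAt34_weilCert3C : weilCert3C.checkNuAt 34 = true := by
  decide +kernel

end Literature.NumberTheory.LFunctions
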